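import Mathlib
import HarnessLib.Audit
import Summits.PneNP.PneNP.Theorems.PstarCrossCaseU2
import Summits.PneNP.PneNP.Theorems.PstarCrossCasePEmptyToggle
import Summits.PneNP.PneNP.Theorems.PstarCrossBudget
import Summits.PneNP.PneNP.Theorems.PstarChordBridgeFundamental

/-!
# The blind free CROSS gate, regime U2 (node N4): the CLEAN rows are empty — if both state-free parts are constant or `u_{e₀} +` constant, no private tree edge is read (O2 / E1; prover-1 g22)

FRONTIER range-avoidance ladder, rung F-N3 (`stmt-PneNP-19007`), cell `pnp-ideate`; restricted-model proof complexity — nothing here bears on `P` versus `NP`.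

Node N4 (`PstarCrossNodes.CrossU2`).  `PstarCrossCaseU2.qDir10_cases` / `qDir01_cases` put each of `q_{(1,0)} + κ₂`, `q_{(0,1)} + κ₁` in one of the rows
`0`, `u_{e₀}`, product.  This file kills the four CLEAN combinations (no product row):

* `exists_privEdge` — the budget `#(J₀∖N) + 3 ≤ #N + 2·#Pv` (`PstarCrossBudget.cross_budget`) supplies a private tree edge as soon as `#N < #(J₀∖N) + 3`
  (here `#N = 3` and `#(J₀∖N) ≥ #(D e₀) ≥ 2`);
* `untouched_of_clean` — a constraint whose `q`-function is constant or `u_{e₀} +` constant reads no AND variable of a private tree edge: no linear term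
  (`PstarGateCasePUnitsTouch.not_mem_C_of_qDir`), and its polar form is `0` or the AND-adjacency of `D e₀`, which at a private edge only pairs the two mates
  (`PstarCrossCasePEmptyToggle.andAdj_priv_iff`, `PstarCrossCornerReads.avoid_of_polar_zero_off_mate`);
* **`false_of_clean`** — hence the clean rows contradict TOUCH (`PstarCrossBudget.cross_touch`).
What remains of N4: a product row for `q_{(1,0)}` or `q_{(0,1)}` (the pins), to be counted with their carriers.
-/

set_option linter.dupNamespace false -- `Summit.PneNP.PneNP.…`: summit = sub-problem name (D-0017 single-conjunct layout)

open Finset Module Literature.Computability.Complexity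
open Summit.PneNP.PneNP.Theorems.PstarFibrePolys (bit)
open Summit.PneNP.PneNP.Theorems.PstarTyped (Typed)
open Summit.PneNP.PneNP.Theorems.PstarSALevel (varSet BoundaryExpanding SimpleOverlap)
open Summit.PneNP.PneNP.Theorems.PstarCentreFree (vars_mem_varSet)
open Summit.PneNP.PneNP.Theorems.PstarProductRank (qform polar)
open Summit.PneNP.PneNP.Theorems.PstarPathRank (AndAdj polar_basis)
open Summit.PneNP.PneNP.Theorems.PstarReadSumset (V2)
open Summit.PneNP.PneNP.Theorems.PstarChordSystem (ChordSystem)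
open Summit.PneNP.PneNP.Theorems.PstarChordBridgeTools
open Summit.PneNP.PneNP.Theorems.PstarChordBridge
open Summit.PneNP.PneNP.Theorems.PstarChordBridgeForcing (freeMon gam sys_u_eq)
open Summit.PneNP.PneNP.Theorems.PstarChordBridgeFundamental (two_le_card_of_even)
open Summit.PneNP.PneNP.Theorems.PstarChordBridgeBasis (qDir polarDir)
open Summit.PneNP.PneNP.Theorems.PstarChordBridgeCorner (qDir_add)
open Summit.PneNP.PneNP.Theorems.PstarGateCasePUnitsTouch (not_mem_C_of_qDir polarDir_single)
open Summit.PneNP.PneNP.Theorems.PstarCrossData (CrossData)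
open Summit.PneNP.PneNP.Theorems.PstarCrossSystem
open Summit.PneNP.PneNP.Theorems.PstarCrossCorner (PrivEdge)
open Summit.PneNP.PneNP.Theorems.PstarCrossCornerReads (avoid_of_polar_zero_off_mate)
open Summit.PneNP.PneNP.Theorems.PstarCrossBudget (cross_budget cross_touch)
open Summit.PneNP.PneNP.Theorems.PstarCrossCasePEmptyToggle (andAdj_priv_iff)
open Summit.PneNP.PneNP.Theorems.PstarCrossCaseU2 (u_add)

namespace Summit.PneNP.PneNP.Theorems.PstarCrossCaseU2Clean

variable {n m : ℕ}

section

variable (I : LocalMap 4 n m) {r : ℕ} {B : BridgeData n m} {e_p e_q g₀ : Fin m}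

/-- **The budget supplies a private tree edge** whenever `#N < #(J₀ ∖ N) + 3`. -/
theorem exists_privEdge (hB : BoundaryExpanding r I) (hD : CrossData I r B e_p e_q g₀) (hlt : B.N.card < (B.J₀ \ B.N).card + 3) :
    ∃ π, PrivEdge I B π := by
  classical
  obtain ⟨Pv, hPv, hpriv, hcount⟩ := cross_budget I hB hD
  obtain ⟨π, hπ⟩ : Pv.Nonempty := by rw [← card_pos]; omega
  exact ⟨π, hPv hπ, fun j hj hne => hpriv π hπ j (mem_insert_of_mem hj) hne⟩

/-- **TOUCH, contrapositive packaging**: if no private tree edge is read by either constraint and `#N < #(J₀ ∖ N) + 3`, contradiction. -/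
theorem false_of_untouched (hI : I.IsPure xorAndPred) (hB : BoundaryExpanding r I) (hD : CrossData I r B e_p e_q g₀)
    (hlt : B.N.card < (B.J₀ \ B.N).card + 3)
    (h : ∀ π, PrivEdge I B π →
      (I.vars π 2 ∉ B.C₁ ∧ I.vars π 3 ∉ B.C₁) ∧ (I.vars π 2 ∉ B.C₂ ∧ I.vars π 3 ∉ B.C₂) ∧
      (∀ g ∈ B.G₁, I.vars g 2 ≠ I.vars π 2 ∧ I.vars g 3 ≠ I.vars π 2 ∧ I.vars g 2 ≠ I.vars π 3 ∧ I.vars g 3 ≠ I.vars π 3) ∧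
      (∀ g ∈ B.G₂, I.vars g 2 ≠ I.vars π 2 ∧ I.vars g 3 ≠ I.vars π 2 ∧ I.vars g 2 ≠ I.vars π 3 ∧ I.vars g 3 ≠ I.vars π 3)) : False := by
  obtain ⟨π, hπ⟩ := exists_privEdge I hB hD hlt
  obtain ⟨hC₁, hC₂, hG₁, hG₂⟩ := h π hπ
  exact cross_touch I hI hD hπ.1 hπ.2 hC₁ hC₂ hG₁ hG₂

/-- **A clean `q`-row reads no private tree edge.**  For `mv ∈ {(1,0), (0,1)}` let `(C, G, T)` be the corresponding constraint; if `q_{mv}` is constant or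
`u_{e₀} +` constant as a function, then `C` contains neither AND variable of a private tree edge `π` and no monomial of `G` contains one. -/
theorem untouched_of_clean (hI : I.IsPure xorAndPred) (hS : SimpleOverlap I) (hD : CrossData I r B e_p e_q g₀) {e₀ : Fin m}
    (he₀ : e₀ ∈ B.N) {mv : V2} {C : Finset (Fin n)} {G T : Finset (Fin m)} (hTJ : T ⊆ B.J₀ \ B.N) (hGJ : Disjoint G B.J₀)
    (hGfree : ∀ g ∈ G, ¬ (I.vars g 2 ∈ privs I B.N ∨ I.vars g 3 ∈ privs I B.N))
    (hlin : ∀ (π : Fin m) (s : Fin 4), π ∈ B.J₀ \ B.N → 2 ≤ s.val → qDir I B mv (Pi.single (I.vars π s) 1) = qDir I B mv 0 → I.vars π s ∉ C)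
    (hpol : ∀ c d : Fin n, polarDir I B mv (Pi.single c 1) (Pi.single d 1) =
      ((polar T (fun j => I.vars j 2) (fun j => I.vars j 3) + polar (freeMon I B.N G) (fun j => I.vars j 2) (fun j => I.vars j 3) :
        LinearMap.BilinForm (ZMod 2) (Fin n → ZMod 2)) (Pi.single c 1)) (Pi.single d 1))
    {κ : ZMod 2} (hrow : (∀ x, qDir I B mv x + κ = 0) ∨ (∀ x, qDir I B mv x + κ = (sys I B).u e₀ x))
    {π : Fin m} (hπ : PrivEdge I B π) :
    (I.vars π 2 ∉ C ∧ I.vars π 3 ∉ C) ∧ ∀ g ∈ G, I.vars g 2 ≠ I.vars π 2 ∧ I.vars g 3 ≠ I.vars π 2 ∧ I.vars g 2 ≠ I.vars π 3 ∧ I.vars g 3 ≠ I.vars π 3 := by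
  classical
  have hDJ : B.D e₀ ⊆ B.J₀ := (hD.wf.hD e₀ he₀).trans sdiff_subset
  -- no linear term at an AND variable of a tree edge
  have hlin' : ∀ s : Fin 4, (s = 2 ∨ s = 3) → qDir I B mv (Pi.single (I.vars π s) 1) = qDir I B mv 0 := by
    intro s hs
    have e0 : ∀ a b k : ZMod 2, a + k = b + k → a = b := by decide
    rcases hrow with h | h
    · exact e0 _ _ κ (by rw [h, h])
    · refine e0 _ _ κ ?_
      rw [h, h, sys_u_eq, sys_u_eq, PstarChordBridgeFlat.qform_single I hI, PstarChordBridgeFlat.qform_zero]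
  -- the polar form: `0` or the adjacency of `D e₀`
  have hpol' : ∀ x y, polarDir I B mv x y = 0 ∨ polarDir I B mv x y = polar (B.D e₀) (fun j => I.vars j 2) (fun j => I.vars j 3) x y := by
    intro x y
    have e := qDir_add I B mv x y
    rcases hrow with h | h
    · left
      have hx : ∀ z, qDir I B mv z = κ := fun z => by
        have e1 : ∀ a k : ZMod 2, a + k = 0 → a = k := by decide
        exact e1 _ _ (h z)
      rw [hx, hx, hx, hx] at e
      have e2 : ∀ k b : ZMod 2, k = k + k + k + b → b = 0 := by decide
      exact e2 _ _ e
    · right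
      have hx : ∀ z, qDir I B mv z = (sys I B).u e₀ z + κ := fun z => by
        have e1 : ∀ a k u : ZMod 2, a + k = u → a = u + k := by decide
        exact e1 _ _ _ (h z)
      rw [hx, hx, hx, hx, u_add I B e₀ x y] at e
      have e2 : ∀ ux uy u0 p k b : ZMod 2, ux + uy + u0 + p + k = ux + k + (uy + k) + (u0 + k) + b → b = p := by decide
      exact e2 _ _ _ _ _ _ e
  have hoff : ∀ s s' : Fin 4, (s = 2 ∨ s = 3) → (s' = 2 ∨ s' = 3) → s ≠ s' → ∀ w, w ≠ I.vars π 2 → w ≠ I.vars π 3 →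
      ((polar T (fun j => I.vars j 2) (fun j => I.vars j 3) + polar (freeMon I B.N G) (fun j => I.vars j 2) (fun j => I.vars j 3) :
        LinearMap.BilinForm (ZMod 2) (Fin n → ZMod 2)) (Pi.single w 1)) (Pi.single (I.vars π s) 1) = 0 := by
    intro s s' hs hs' hss' w hw2 hw3
    rw [← hpol]
    rcases hpol' (Pi.single w 1) (Pi.single (I.vars π s) 1) with h | h
    · exact h
    · rw [h, polar_basis I hI hS, if_neg]
      intro hA
      have hws' := ((andAdj_priv_iff I hI hDJ hπ hs hs' hss' w).1 hA).2
      rcases hs' with rfl | rfl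
      · exact hw2 hws'
      · exact hw3 hws'
  refine ⟨⟨hlin π 2 hπ.1 (by decide) (hlin' 2 (Or.inl rfl)), hlin π 3 hπ.1 (by decide) (hlin' 3 (Or.inr rfl))⟩, fun g hg => ?_⟩
  have hgf : g ∈ freeMon I B.N G := mem_filter.2 ⟨hg, hGfree g hg⟩
  have h2 := avoid_of_polar_zero_off_mate I hI hS (hTJ.trans sdiff_subset) hGJ hπ (Or.inl rfl) (hoff 2 3 (Or.inl rfl) (Or.inr rfl) (by decide)) g hgf
  have h3 := avoid_of_polar_zero_off_mate I hI hS (hTJ.trans sdiff_subset) hGJ hπ (Or.inr rfl) (hoff 3 2 (Or.inr rfl) (Or.inl rfl) (by decide)) g hgf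
  exact ⟨h2.1, h2.2, h3.1, h3.2⟩

/-- **Node N4: the four clean rows are empty.** -/
theorem false_of_clean (hI : I.IsPure xorAndPred) (hT : Typed I) (hS : SimpleOverlap I) (hB : BoundaryExpanding r I) (hD : CrossData I r B e_p e_q g₀)
    {e₀ : Fin m} (hE : (B.N.erase e_q).erase e_p = {e₀})
    {κ₂ : ZMod 2} (h10 : (∀ x, qDir I B (1, 0) x + κ₂ = 0) ∨ (∀ x, qDir I B (1, 0) x + κ₂ = (sys I B).u e₀ x))
    {κ₁ : ZMod 2} (h01 : (∀ x, qDir I B (0, 1) x + κ₁ = 0) ∨ (∀ x, qDir I B (0, 1) x + κ₁ = (sys I B).u e₀ x)) : False := by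
  classical
  have hW := hD.wf
  have he₀' : e₀ ∈ (B.N.erase e_q).erase e_p := by rw [hE]; exact mem_singleton_self _
  have he₀ : e₀ ∈ B.N := mem_of_mem_erase (mem_of_mem_erase he₀')
  -- `#N = 3` and `#(J₀ ∖ N) ≥ 2`
  have hN : B.N = insert e_q (insert e_p {e₀}) := by
    rw [← insert_erase hD.mem_q, ← insert_erase (mem_erase.2 ⟨hD.ne, hD.mem_p⟩ : e_p ∈ B.N.erase e_q), hE]
  have hN3 : B.N.card = 3 := by
    rw [hN, card_insert_of_notMem, card_insert_of_notMem, card_singleton]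
    · exact fun h => (ne_of_mem_erase he₀').symm (mem_singleton.1 h)
    · rw [mem_insert, mem_singleton]; push Not
      exact ⟨hD.ne.symm, fun h => (ne_of_mem_erase (mem_of_mem_erase he₀')).symm h⟩
  have hDe : 2 ≤ (B.D e₀).card :=
    two_le_card_of_even I hI hS (fun h => (mem_sdiff.1 (hW.hD e₀ he₀ h)).2 he₀) (hW.hDeven e₀ he₀)
  have ht : 2 ≤ (B.J₀ \ B.N).card := hDe.trans (card_le_card (hW.hD e₀ he₀))
  have hGfree : ∀ G : Finset (Fin m), (∀ v ∈ privs I B.N, ∀ g ∈ G, I.vars g 2 ≠ v ∧ I.vars g 3 ≠ v) →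
      ∀ g ∈ G, ¬ (I.vars g 2 ∈ privs I B.N ∨ I.vars g 3 ∈ privs I B.N) := by
    intro G h g hg hor
    rcases hor with h2 | h3
    · exact (h _ h2 g hg).1 rfl
    · exact (h _ h3 g hg).2 rfl
  refine false_of_untouched I hI hB hD (by omega) fun π hπ => ?_
  have hd₁ : Disjoint B.G₁ B.J₀ := Finset.disjoint_of_subset_left (subset_insert g₀ B.G₁) hD.disj₁
  obtain ⟨hC₁, hG₁⟩ := untouched_of_clean I hI hS hD he₀ (mv := (0, 1)) hW.hT₁ hd₁ (hGfree B.G₁ fun v hv => (hD.hun v hv).1)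
    (fun π s hπ hs h => (not_mem_C_of_qDir I hI hT hW hπ hs).1 h) (fun c d => by rw [polarDir_single]; simp) h01 hπ
  obtain ⟨hC₂, hG₂⟩ := untouched_of_clean I hI hS hD he₀ (mv := (1, 0)) hW.hT₂ hD.disj₂ (hGfree B.G₂ fun v hv => (hD.hun v hv).2)
    (fun π s hπ hs h => (not_mem_C_of_qDir I hI hT hW hπ hs).2 h) (fun c d => by rw [polarDir_single]; simp) h10 hπ
  exact ⟨hC₁, hC₂, hG₁, hG₂⟩

end

end Summit.PneNP.PneNP.Theorems.PstarCrossCaseU2Clean
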